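import Summits.Langlands.Langlands.Theorems.PicardMuOrdinaryMuOrdinaryFamilyRTPointPlan

/-!
# The Picard point of line `free-seed-smooth-rt` (crux `MuOrdinaryFamilyRT`, stmt-Langlands-13757):
# LEAF `rbarPolarized` — the heart is polarized modulo `3`

Helper file for the registered stub `stub_point` (plan: `…PointPlan.lean`).  PROVED, unconditionally:
`theorem rbarPolarized : Leaf.rbarPolarized`, i.e. for every basis `B` of the heart, every
`ℤ₃`-algebra `𝒪` with a map to `𝔽₃`, every `m ∈ ℤ`, `c ∈ Γ_ℚ` and `σ ∈ Γ_K`: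
`tr r̄_f^B(θ_c σ) = ε̄(σ)^m · tr r̄_f^B(σ⁻¹)` in `𝔽₃`.  Ingredients:

* `cyclotomicCharacter_sub_one_mem_span`, `algebraMap_cyclotomicCharacter_zpow` — `ε(σ) ≡ 1 (mod 3)`
  for `σ ∈ Γ_K` (`σ` fixes `ζ₃ ∈ K`; `GaloisRep.cyclotomicCharacter_spec`), so `ε̄(σ)^m = 1` in `𝔽₃`
  through ANY `ℤ₃ → 𝒪 → 𝔽₃`;
* `heartRep_eq_perm`, `heartTrace_conj`, `heartTrace_inv` — the heart of `G` on `Ω` factors through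
  `Sym(Ω)`, and its character is a class function taking the same value at `π` and `π⁻¹`
  (`π⁻¹ ∼ π` in `Sym(Ω)`, `Equiv.Perm.isConj_iff_cycleType_eq`);
* `absGaloisOuterConj_smul`, `toPerm_absGaloisOuterConj` — `θ_c σ` acts on `K̄` as `C_c ∘ σ ∘ C_c⁻¹`
  for the ring automorphism `C_c = ι₀ c ι₀⁻¹` (`ι₀ = absClosureEquiv ℚ K`), which permutes the roots
  of `f ∈ ℤ[X]`; so on the roots `θ_c σ` is a conjugate of `σ` in `Sym(roots)`.
-/

-- `Summit.Langlands.Langlands.…` (summit = sub-problem name, D-0017 layout) trips `dupNamespace` on every decl.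
set_option linter.dupNamespace false

namespace Summit.Langlands.Langlands.Cruxes.MuOrdinaryFamilyRT.FreeSeedSmoothRt

open scoped NumberField Polynomial Matrix Classical
open Field IsDedekindDomain Polynomial IsLocalRing
open Literature.NumberTheory.GaloisRepresentations

noncomputable section

/-! ### `ε ≡ 1 (mod 3)` on `Γ_K` -/

/-- The `3`-adic cyclotomic character of `Γ_K`, `K = ℚ(ζ₃)`, is `≡ 1 (mod 3)`: `σ` fixes `ζ₃ ∈ K`. -/
theorem cyclotomicCharacter_sub_one_mem_span (σ : absoluteGaloisGroup K) :
    ((GaloisRep.cyclotomicCharacter K 3 σ : ℤ_[3]ˣ) : ℤ_[3]) - 1 ∈ Ideal.span {((3 : ℕ) : ℤ_[3]) ^ 1} := by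
  set t : AlgebraicClosure K := algebraMap K (AlgebraicClosure K) zetaK with ht
  have hprim : IsPrimitiveRoot t 3 :=
    isPrimitiveRoot_zetaK.map_of_injective (algebraMap K (AlgebraicClosure K)).injective
  have ht3 : t ^ 3 ^ 1 = 1 := by rw [pow_one]; exact hprim.pow_eq_one
  have hfix : σ • t = t := by
    rw [absoluteGaloisGroup.smul_def, ht, AlgEquiv.commutes]
  have hspec := GaloisRep.cyclotomicCharacter_spec K 3 σ t ht3
  rw [hfix] at hspec
  set a := (((GaloisRep.cyclotomicCharacter K 3 σ : ℤ_[3]ˣ) : ℤ_[3]).toZModPow 1) with ha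
  have hlt : a.val < 3 := by
    have := a.val_lt
    simpa using this
  have ha1 : a.val = 1 :=
    hprim.pow_inj hlt (by norm_num) (hspec.symm.trans (pow_one t).symm)
  have ha1' : a = 1 := by
    rw [← ZMod.natCast_zmod_val a, ha1, Nat.cast_one]
  rw [← PadicInt.ker_toZModPow, RingHom.mem_ker, map_sub, map_one, ← ha, ha1', sub_self]

/-- For any `ℤ₃`-algebra `𝒪` with a map to `𝔽₃`: the image of `ε(σ)^m` in `𝔽₃` is `1` (`σ ∈ Γ_K`). -/
theorem algebraMap_cyclotomicCharacter_zpow (𝒪 : Type) [CommRing 𝒪] [Algebra ℤ_[3] 𝒪] [Algebra 𝒪 (ZMod 3)]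
    (m : ℤ) (σ : absoluteGaloisGroup K) :
    algebraMap 𝒪 (ZMod 3) (algebraMap ℤ_[3] 𝒪 (((GaloisRep.cyclotomicCharacter K 3 σ) ^ m : ℤ_[3]ˣ) : ℤ_[3])) = 1 := by
  set φ : ℤ_[3] →+* ZMod 3 := (algebraMap 𝒪 (ZMod 3)).comp (algebraMap ℤ_[3] 𝒪) with hφ
  set u : ℤ_[3]ˣ := GaloisRep.cyclotomicCharacter K 3 σ with hu
  have h3 : φ 3 = 0 := by rw [map_ofNat]; decide
  have hu1 : φ (u : ℤ_[3]) = 1 := by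
    obtain ⟨y, hy⟩ := Ideal.mem_span_singleton'.mp (cyclotomicCharacter_sub_one_mem_span σ)
    rw [pow_one, Nat.cast_ofNat] at hy
    have : (u : ℤ_[3]) = 1 + y * 3 := by rw [hy]; ring
    rw [this, map_add, map_one, map_mul, h3, mul_zero, add_zero]
  have hunit : Units.map (φ : ℤ_[3] →* ZMod 3) u = 1 := Units.ext hu1
  change φ ((u ^ m : ℤ_[3]ˣ) : ℤ_[3]) = 1
  have : φ ((u ^ m : ℤ_[3]ˣ) : ℤ_[3]) = ((Units.map (φ : ℤ_[3] →* ZMod 3) (u ^ m) : (ZMod 3)ˣ) : ZMod 3) := rfl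
  rw [this, map_zpow, hunit, one_zpow, Units.val_one]

/-! ### The heart factors through the permutation group of the roots; its trace is a class function -/

section Perm

variable (p : ℕ) (Ω : Type) {G : Type*} [Group G] [MulAction G Ω]

/-- The permutation representation of `G` on `Ω` is that of `Sym(Ω)` composed with `G → Sym(Ω)`. -/
theorem permRep_eq_perm (g : G) :
    permRep (ZMod p) G Ω g = permRep (ZMod p) (Equiv.Perm Ω) Ω (MulAction.toPerm g) := by
  refine Finsupp.lhom_ext' fun x => LinearMap.ext_ring ?_
  rw [LinearMap.comp_apply, LinearMap.comp_apply, Finsupp.lsingle_apply, permRep_single, permRep_single]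
  rfl

/-- The heart of `G` on `Ω` is the heart of `Sym(Ω)` composed with `G → Sym(Ω)`. -/
theorem heartRep_eq_perm [Fintype Ω] (g : G) :
    heartRep p Ω G g = heartRep p Ω (Equiv.Perm Ω) (MulAction.toPerm g) := by
  refine LinearMap.ext fun x => ?_
  obtain ⟨x, rfl⟩ := Submodule.Quotient.mk_surjective _ x
  rw [heartRep_mk, heartRep_mk]
  congr 1

variable [Fintype Ω]

/-- The character of the heart of `Sym(Ω)`. -/
def heartTrace (π : Equiv.Perm Ω) : ZMod p :=
  LinearMap.trace (ZMod p) (Heart p Ω) (heartRep p Ω (Equiv.Perm Ω) π)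

/-- The character of the heart is a class function on `Sym(Ω)`. -/
theorem heartTrace_conj (τ π : Equiv.Perm Ω) : heartTrace p Ω (τ * π * τ⁻¹) = heartTrace p Ω π := by
  rw [heartTrace, heartTrace, (heartRep p Ω (Equiv.Perm Ω)).map_mul, (heartRep p Ω (Equiv.Perm Ω)).map_mul,
    LinearMap.trace_mul_comm, ← mul_assoc, ← (heartRep p Ω (Equiv.Perm Ω)).map_mul, inv_mul_cancel,
    (heartRep p Ω (Equiv.Perm Ω)).map_one, one_mul]

/-- `π⁻¹` is conjugate to `π` in `Sym(Ω)`, so the heart has the same trace at both. -/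
theorem heartTrace_inv [DecidableEq Ω] (π : Equiv.Perm Ω) : heartTrace p Ω π⁻¹ = heartTrace p Ω π := by
  obtain ⟨τ, hτ⟩ := isConj_iff.mp (Equiv.Perm.isConj_iff_cycleType_eq.mpr (Equiv.Perm.cycleType_inv π).symm)
  rw [← hτ, heartTrace_conj]

end Perm

/-! ### `θ_c σ` permutes the roots like a conjugate of `σ` -/

section OuterConj

variable (f : ℤ[X])

/-- The ring automorphism `C_c = ι₀ ∘ c ∘ ι₀⁻¹` of `K̄` induced by `c ∈ Γ_ℚ` through the chosen
`ι₀ : ℚ̄ ≅ K̄` (`absClosureEquiv ℚ K`); it restricts to complex conjugation on `K` for `c` a complex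
conjugation, and is NOT `K`-linear in general. -/
def outerRingAut (c : absoluteGaloisGroup ℚ) : AlgebraicClosure K ≃+* AlgebraicClosure K :=
  ((absClosureEquiv ℚ K).symm.toRingEquiv.trans (absoluteGaloisGroup.toAlgEquiv ℚ c).toRingEquiv).trans
    (absClosureEquiv ℚ K).toRingEquiv

/-- `C_c α = ι₀ (c • ι₀⁻¹ α)`. -/
theorem outerRingAut_apply (c : absoluteGaloisGroup ℚ) (α : AlgebraicClosure K) :
    outerRingAut c α = absClosureEquiv ℚ K (c • (absClosureEquiv ℚ K).symm α) := rfl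

/-- `C_c⁻¹ α = ι₀ (c⁻¹ • ι₀⁻¹ α)`. -/
theorem outerRingAut_symm_apply (c : absoluteGaloisGroup ℚ) (α : AlgebraicClosure K) :
    (outerRingAut c).symm α = absClosureEquiv ℚ K (c⁻¹ • (absClosureEquiv ℚ K).symm α) := by
  apply (outerRingAut c).injective
  rw [RingEquiv.apply_symm_apply, outerRingAut_apply, AlgEquiv.symm_apply_apply, smul_inv_smul,
    AlgEquiv.apply_symm_apply]

/-- **`θ_c σ` acts on `K̄` as `C_c ∘ σ ∘ C_c⁻¹`.** -/
theorem absGaloisOuterConj_smul (c : absoluteGaloisGroup ℚ) (σ : absoluteGaloisGroup K) (α : AlgebraicClosure K) :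
    absGaloisOuterConj ℚ K c σ • α = outerRingAut c (σ • (outerRingAut c).symm α) := by
  have key : ∀ (τ : absoluteGaloisGroup K) (x : AlgebraicClosure ℚ),
      τ • absClosureEquiv ℚ K x = absClosureEquiv ℚ K (absGaloisRestrict ℚ K τ • x) := fun τ x => by
    rw [absClosureEquiv_apply, absClosureEquiv_apply, absGaloisRestrict_apply_smul]
  set x := (absClosureEquiv ℚ K).symm α with hx
  have hα : α = absClosureEquiv ℚ K x := ((absClosureEquiv ℚ K).apply_symm_apply α).symm
  rw [outerRingAut_symm_apply, ← hx, key, outerRingAut_apply, AlgEquiv.symm_apply_apply, hα, key,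
    absGaloisRestrict_absGaloisOuterConj, mul_smul, mul_smul]

/-- `C_c` preserves the roots of `f` (which has integer coefficients). -/
theorem outerRingAut_mem_roots_iff (c : absoluteGaloisGroup ℚ) (α : AlgebraicClosure K) :
    α ∈ (f.map (algebraMap ℤ K)).rootSet (AlgebraicClosure K) ↔
      outerRingAut c α ∈ (f.map (algebraMap ℤ K)).rootSet (AlgebraicClosure K) := by
  have h : ∀ (C : AlgebraicClosure K ≃+* AlgebraicClosure K) (β : AlgebraicClosure K),
      aeval (C β) (f.map (algebraMap ℤ K)) = C (aeval β (f.map (algebraMap ℤ K))) := fun C β => by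
    rw [aeval_map_algebraMap, aeval_map_algebraMap, aeval_def, aeval_def]
    change _ = C.toRingHom (eval₂ (algebraMap ℤ (AlgebraicClosure K)) β f)
    rw [hom_eval₂, RingHom.ext_int (C.toRingHom.comp (algebraMap ℤ (AlgebraicClosure K))) (algebraMap ℤ _)]
    rfl
  simp only [mem_rootSet, h, map_eq_zero_iff _ (outerRingAut c).injective]

/-- `C_c` restricted to the roots of `f`. -/
def outerRootPerm (c : absoluteGaloisGroup ℚ) : Equiv.Perm (Roots f) :=
  (outerRingAut c).toEquiv.subtypeEquiv fun α => outerRingAut_mem_roots_iff f c α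

/-- **On the roots, `θ_c σ` is the conjugate of `σ` by the permutation `C_c`.** -/
theorem toPerm_absGaloisOuterConj (c : absoluteGaloisGroup ℚ) (σ : absoluteGaloisGroup K) :
    (MulAction.toPerm (absGaloisOuterConj ℚ K c σ) : Equiv.Perm (Roots f)) =
      outerRootPerm f c * MulAction.toPerm σ * (outerRootPerm f c)⁻¹ := by
  refine Equiv.ext fun α => Subtype.ext ?_
  rw [MulAction.toPerm_apply, Equiv.Perm.mul_apply, Equiv.Perm.mul_apply, MulAction.toPerm_apply,
    rootSet.coe_smul, absGaloisOuterConj_smul c σ α]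
  rfl

end OuterConj

/-! ### The leaf -/

/-- The trace of `r̄_f^B(g)` is the heart character at the permutation of the roots induced by `g`. -/
theorem trace_rbar_eq_heartTrace (f : ℤ[X]) (B : Module.Basis (Fin 3) (ZMod 3) (Heart 3 (Roots f)))
    (g : absoluteGaloisGroup K) :
    (rbar f B g).val.trace = heartTrace 3 (Roots f) (MulAction.toPerm g) := by
  rw [heartTrace, ← heartRep_eq_perm, LinearMap.trace_eq_matrix_trace (ZMod 3) B]
  rfl

/-- `tr r̄_f^B(θ_c σ) = ε̄(σ)^m · tr r̄_f^B(σ⁻¹)` for every `m` and `c ∈ Γ_ℚ`. -/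
theorem rbarPolarized' (f : ℤ[X]) (B : Module.Basis (Fin 3) (ZMod 3) (Heart 3 (Roots f)))
    (𝒪 : Type) [CommRing 𝒪] [Algebra ℤ_[3] 𝒪] [Algebra 𝒪 (ZMod 3)] (m : ℤ)
    (c : absoluteGaloisGroup ℚ) (σ : absoluteGaloisGroup K) :
    (rbar f B (absGaloisOuterConj ℚ K c σ)).val.trace =
      algebraMap 𝒪 (ZMod 3) (algebraMap ℤ_[3] 𝒪 (((GaloisRep.cyclotomicCharacter K 3 σ) ^ m : ℤ_[3]ˣ) : ℤ_[3])) *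
        (rbar f B σ⁻¹).val.trace := by
  have hinv : (MulAction.toPerm σ⁻¹ : Equiv.Perm (Roots f)) = (MulAction.toPerm σ)⁻¹ :=
    map_inv (MulAction.toPermHom (absoluteGaloisGroup K) (Roots f)) σ
  rw [algebraMap_cyclotomicCharacter_zpow, one_mul, trace_rbar_eq_heartTrace, trace_rbar_eq_heartTrace,
    toPerm_absGaloisOuterConj, heartTrace_conj, hinv, heartTrace_inv]

/-- **LEAF `rbarPolarized`** (registered helper goal of `stub_point`): the heart `r̄_f^B` is polarized
modulo `3` for every exponent `m` and every `c ∈ Γ_ℚ`. -/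
theorem rbarPolarized : Leaf.rbarPolarized :=
  fun f B 𝒪 _ _ _ m c σ => rbarPolarized' f B 𝒪 m c σ

end

end Summit.Langlands.Langlands.Cruxes.MuOrdinaryFamilyRT.FreeSeedSmoothRt
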